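import Summits.CriticalPhenomena.PercolationContinuityZ3.Theorems.PercNearOneGluingNoHeavyLowerTailSunflowerOpenProductPositivity

/-!
# `NoHeavyLowerTail` (crux stmt-CriticalPhenomena-4575), abstract sunflower cubic: THE SUPPORT PROPERTY OF THE OPEN PRODUCT
# — every monomial of `1 - ∏_{S ∈ 𝒪} t_S` has an OPEN support (memo FINDING-PAR-prove1-g46 §3b, used for THEOREM 4 / (MC-atomic))

Support file (seat `prim-ineq-prove-1` gen 46; `--supports stmt-CriticalPhenomena-4575`).  Continues `…SunflowerOpenProductPositivity`.
A configuration is FAITHFUL if every monomial of `m C` has support exactly `C`.  The initial configuration is faithful, the elimination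
`elim m C` preserves faithfulness (a new letter `y·z^i` has degree-support `C_y ∪ C`), and in a terminal configuration `1 - F_𝒪 ≡ y_A`
has only open colours; hence:
* **`support_mem_of_coeff_ne_zero`**: for union-closed `𝒪`, `coeff n (1 - ∏_{S∈𝒪} tS S) ≠ 0 → n.support ∈ 𝒪`.
-/

namespace Summit.CriticalPhenomena.PercolationContinuityZ3.Theorems.SunflowerPartition

namespace OpenProduct

open MvPowerSeries Finset

variable {A : Type*} [DecidableEq A] {m : Finset A → MvPowerSeries A ℚ}

/-- A configuration is faithful: the monomials of `m C` have support exactly `C`. [this work] -/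
def Faithful (m : Finset A → MvPowerSeries A ℚ) : Prop := ∀ C (β : A →₀ ℕ), coeff β (m C) ≠ 0 → β.support = C

omit [DecidableEq A] in
/-- A nonzero coefficient of a product splits into nonzero coefficients of the factors. [this work] -/
theorem exists_of_coeff_mul_ne_zero [DecidableEq A] {φ ψ : MvPowerSeries A ℚ} {β : A →₀ ℕ} (h : coeff β (φ * ψ) ≠ 0) :
    ∃ β₁ β₂ : A →₀ ℕ, β₁ + β₂ = β ∧ coeff β₁ φ ≠ 0 ∧ coeff β₂ ψ ≠ 0 := by
  rw [coeff_mul] at h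
  obtain ⟨x, hx, hne⟩ := exists_ne_zero_of_sum_ne_zero h
  exact ⟨x.1, x.2, Finset.HasAntidiagonal.mem_antidiagonal.mp hx, left_ne_zero_of_mul hne, right_ne_zero_of_mul hne⟩

omit [DecidableEq A] in
/-- A nonzero coefficient of a finite sum comes from a nonzero coefficient of a summand. [this work] -/
theorem exists_of_coeff_sum_ne_zero {κ : Type*} (s : Finset κ) (f : κ → MvPowerSeries A ℚ) {β : A →₀ ℕ}
    (h : coeff β (∑ k ∈ s, f k) ≠ 0) : ∃ k ∈ s, coeff β (f k) ≠ 0 := by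
  rw [map_sum] at h
  exact exists_ne_zero_of_sum_ne_zero h

/-! ## Faithfulness of the initial configuration and of eliminations -/

/-- The initial configuration is faithful. [this work] -/
theorem faithful_m0 : Faithful (m0 A) := by
  intro C β h
  unfold m0 at h
  split_ifs at h with hC
  · obtain ⟨a, ha, hne⟩ := exists_of_coeff_sum_ne_zero C _ h
    rw [coeff_X] at hne
    split_ifs at hne with hβ
    · obtain ⟨b, hb⟩ := card_eq_one.mp hC
      rw [hb, mem_singleton] at ha
      rw [hβ, Finsupp.support_single a one_ne_zero, hb, ha]
    · exact absurd rfl hne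
  · simp at h

/-- The monomials of `(1 - m C)⁻¹` are `1` or have support `C` (faithful `m`). [this work] -/
theorem support_of_coeff_inv_ne_zero (hm : IsConfig m) (hf : Faithful m) (C : Finset A) :
    ∀ β : A →₀ ℕ, coeff β (1 - m C)⁻¹ ≠ 0 → β = 0 ∨ β.support = C := by
  have hrec : (1 - m C)⁻¹ = 1 + m C * (1 - m C)⁻¹ := by
    have h := one_sub_mul_inv hm C
    linear_combination h
  intro β
  induction β using WellFoundedLT.induction with
  | ind β ih =>
    intro hβ
    by_cases hβ0 : β = 0
    · exact Or.inl hβ0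
    · right
      rw [hrec, map_add, coeff_one, if_neg hβ0, zero_add] at hβ
      obtain ⟨β₁, β₂, hsum, h₁, h₂⟩ := exists_of_coeff_mul_ne_zero hβ
      have hβ₁0 : β₁ ≠ 0 := by
        rintro rfl; rw [coeff_zero_eq_constantCoeff_apply, hm.const] at h₁; exact h₁ rfl
      have hs₁ : β₁.support = C := hf C β₁ h₁
      have hlt : β₂ < β := by
        rw [← hsum]
        exact lt_add_of_pos_left β₂ (pos_iff_ne_zero.mpr hβ₁0)
      rcases ih β₂ hlt h₂ with h0 | hs₂
      · rw [← hsum, h0, add_zero, hs₁]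
      · rw [← hsum, Finsupp.support_add_eq_union, hs₁, hs₂, union_idempotent]

/-- The monomials of `g m C` have support `C` (faithful `m`). [this work] -/
theorem support_of_coeff_g_ne_zero (hm : IsConfig m) (hf : Faithful m) (C : Finset A) (β : A →₀ ℕ)
    (hβ : coeff β (g m C) ≠ 0) : β.support = C := by
  rw [g_eq_mul hm C] at hβ
  obtain ⟨β₁, β₂, hsum, h₁, h₂⟩ := exists_of_coeff_mul_ne_zero hβ
  have hs₁ : β₁.support = C := hf C β₁ h₁
  rcases support_of_coeff_inv_ne_zero hm hf C β₂ h₂ with h0 | hs₂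
  · rw [← hsum, h0, add_zero, hs₁]
  · rw [← hsum, Finsupp.support_add_eq_union, hs₁, hs₂, union_idempotent]

/-- Elimination preserves faithfulness. [this work] -/
theorem faithful_elim (hm : IsConfig m) (hf : Faithful m) (C : Finset A) : Faithful (elim m C) := by
  intro S β hβ
  unfold elim at hβ
  rw [map_add] at hβ
  by_cases h1 : coeff β (if S = C then (0 : MvPowerSeries A ℚ) else m S) ≠ 0
  · split_ifs at h1 with hS
    · simp at h1
    · exact hf S β h1
  · rw [not_not] at h1
    rw [h1, zero_add] at hβ
    obtain ⟨β₁, β₂, hsum, hg, hT⟩ := exists_of_coeff_mul_ne_zero hβ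
    obtain ⟨T, hTmem, hT'⟩ := exists_of_coeff_sum_ne_zero _ _ hT
    obtain ⟨-, hTS⟩ := (mem_filter.mp hTmem).2
    rw [← hsum, Finsupp.support_add_eq_union, support_of_coeff_g_ne_zero hm hf C β₁ hg, hf T β₂ hT', union_comm, hTS]

/-! ## The support property of the open product -/

/-- In a faithful configuration whose non-open colours vanish below `d`, a nonzero coefficient of `1 - F_𝒪` of degree `< d` has
open support. [this work] -/
theorem support_mem_of_nonOpen [Fintype A] (hm : IsConfig m) (hf : Faithful m) (𝒪 : Finset (Finset A))
    (h𝒪 : ∀ S ∈ 𝒪, ∀ S' ∈ 𝒪, S ∪ S' ∈ 𝒪) (d : ℕ) (hvan : ∀ C ∈ nonOpen 𝒪, VanLT d (m C)) (n : A →₀ ℕ)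
    (hn : n.degree < d) (hne : coeff n (1 - (F m hm 𝒪 : MvPowerSeries A ℚ)) ≠ 0) : n.support ∈ 𝒪 := by
  rw [coeff_one_sub_F_of_nonOpen hm 𝒪 h𝒪 d hvan n hn, y] at hne
  obtain ⟨C, -, hC⟩ := exists_of_coeff_sum_ne_zero _ _ hne
  have hsupp : n.support = C := hf C n hC
  by_contra hnot
  by_cases hC0 : C = ∅
  · rw [hC0, hm.empty] at hC; simp at hC
  · exact hC (hvan C (mem_nonOpen.mpr ⟨nonempty_iff_ne_empty.mpr hC0, hsupp ▸ hnot⟩) n hn)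

/-- The induction of `coeff_one_sub_F_nonneg_aux`, transporting the support property. [this work] -/
theorem support_mem_aux [Fintype A] (𝒪 : Finset (Finset A)) (h𝒪 : ∀ S ∈ 𝒪, ∀ S' ∈ 𝒪, S ∪ S' ∈ 𝒪) (N : ℕ) :
    ∀ k d : ℕ, d + k = N + 1 → ∀ (m : Finset A → MvPowerSeries A ℚ) (hm : IsConfig m), Faithful m →
      (∀ C ∈ nonOpen 𝒪, VanLT d (m C)) → ∀ n : A →₀ ℕ, n.degree ≤ N →
        coeff n (1 - (F m hm 𝒪 : MvPowerSeries A ℚ)) ≠ 0 → n.support ∈ 𝒪 := by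
  classical
  intro k
  induction k with
  | zero =>
    intro d hd m hm hf hvan n hn hne
    exact support_mem_of_nonOpen hm hf 𝒪 h𝒪 d hvan n (by omega) hne
  | succ k ih =>
    intro d hd
    suffices hc : ∀ c : ℕ, ∀ (m : Finset A → MvPowerSeries A ℚ) (hm : IsConfig m), Faithful m →
        (bad 𝒪 m d).card = c → (∀ C ∈ nonOpen 𝒪, VanLT d (m C)) → ∀ n : A →₀ ℕ, n.degree ≤ N →
          coeff n (1 - (F m hm 𝒪 : MvPowerSeries A ℚ)) ≠ 0 → n.support ∈ 𝒪 from
      fun m hm hf hvan n hn => hc _ m hm hf rfl hvan n hn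
    intro c
    induction c using Nat.strong_induction_on with
    | _ c ihc =>
      intro m hm hf hcard hvan n hn hne
      by_cases hbad : bad 𝒪 m d = ∅
      · refine ih (d + 1) (by omega) m hm hf (fun C hC n' hn' => ?_) n hn hne
        rcases Nat.lt_succ_iff_lt_or_eq.mp hn' with hlt | heq
        · exact hvan C hC n' hlt
        · have : C ∉ bad 𝒪 m d := by rw [hbad]; exact notMem_empty C
          simp only [bad, mem_filter, not_and, not_not] at this
          exact this hC n' heq
      · obtain ⟨C, hCbad⟩ := nonempty_iff_ne_empty.mpr hbad
        have hCQ : C ∈ nonOpen 𝒪 := (mem_filter.mp hCbad).1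
        have hC𝒪 : C ∉ 𝒪 := (mem_nonOpen.mp hCQ).2
        have hCvan : VanLT d (m C) := hvan C hCQ
        have hlt : (bad 𝒪 (elim m C) d).card < c := by
          calc (bad 𝒪 (elim m C) d).card ≤ ((bad 𝒪 m d).erase C).card :=
                card_le_card (bad_elim_subset 𝒪 hm hCvan)
            _ < (bad 𝒪 m d).card := card_erase_lt_of_mem hCbad
            _ = c := hcard
        rw [← F_elim hm C 𝒪 hC𝒪] at hne
        exact ihc _ hlt (elim m C) (isConfig_elim hm C) (faithful_elim hm hf C) rfl
          (fun S hS => vanLT_elim hm hCvan S fun _ => hvan S hS) n hn hne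

/-- **SUPPORT PROPERTY**: for a union-closed `𝒪`, every monomial of `1 - ∏_{S∈𝒪} t_S` has open support. [this work] -/
theorem support_mem_of_coeff_ne_zero [Fintype A] (𝒪 : Finset (Finset A)) (h𝒪 : ∀ S ∈ 𝒪, ∀ S' ∈ 𝒪, S ∪ S' ∈ 𝒪)
    (n : A →₀ ℕ) (hne : coeff n (1 - ∏ S ∈ 𝒪, tS S) ≠ 0) : n.support ∈ 𝒪 := by
  have h : coeff n (1 - (F (m0 A) isConfig_m0 𝒪 : MvPowerSeries A ℚ)) ≠ 0 := by
    rwa [F, Units.coe_prod, prod_congr rfl fun S _ => val_T_m0 S]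
  exact support_mem_aux 𝒪 h𝒪 n.degree n.degree 1 (by omega) (m0 A) isConfig_m0 faithful_m0
    (fun C _ => vanLT_one_of_isConfig isConfig_m0 C) n le_rfl h

end OpenProduct

end Summit.CriticalPhenomena.PercolationContinuityZ3.Theorems.SunflowerPartition
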